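import Literature.MathematicalPhysics.QuantumLattice.TorusShellCounting
import Literature.MathematicalPhysics.QuantumLattice.TorusBandEdgeCounting

/-!
# `TwTipContinuation` (stmt-HubbardSuperconductivity-1700) — weak-coupling darkness, piece 1:
# level counting in thin shells, uniformly in the chemical potential

For the free band `ε_L(k) = -2cos(2πk₁/L) - 2cos(2πk₂/L)` of the `L × L` torus (`torusBand`) we
prove the density-of-states bound

  `#{k ∈ (ℤ/Lℤ)² : |ε_L(k) - μ| < t} ≤ L (L √(t/2) + 2)`   for every real `μ` and every `t ≥ 0`

(`card_torusShell_le_sqrt`), uniform in `μ` — including the band edges `μ = ±4` and the van Hove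
energy `μ = 0`, where the sharper (linear in `t`) count of `TorusShellCounting.card_torusShell_le`
degenerates. The square root is the worst case (band edge, `#{ε < -4 + t} ∼ tL²` is NOT what is
counted here: the shell `|ε + 4| < t` has `∼ tL²` points, and `t ≤ √t` for `t ≤ 1`; the `√t` loss
comes from the flat rows `θ₂ ≈ 0, π`).

Method (finite combinatorics only): on a row `θ₂ = const` the condition reads `|cos θ₁ - c| < t/2`;
two angles `θ, φ ∈ [0, π]` with `|cos θ - cos φ| < 2h` satisfy `|θ - φ| < π√h`
(`abs_sub_lt_pi_mul_sqrt`, from `cos θ - cos φ = 2 sin((θ+φ)/2) sin((φ-θ)/2)` and Jordan's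
inequality), so the folded indices `min(a, L-a)` of the row's solutions lie in a real interval of
length `< L√h/2` and number `≤ L√h/2 + 1`; folding is two-to-one. Used by the weak-coupling
darkness bound (`ThermalWedgeTwTipContinuationWeakCouplingDarkness.lean`): the kinetic-energy
budget `U L²` of a ground state cannot pay for a smeared Fermi surface outside a thin shell, and
the shell itself is too small to carry `O(L⁴)` pair coherence.
-/

noncomputable section

namespace Summit.HubbardSuperconductivity.TwTipContinuation.WeakCouplingDarkness

open Real Set Finset
open Literature.MathematicalPhysics.QuantumLattice Literature.Probability.LatticeModels

/-! ### Two angles with close cosines are close (square-root modulus, uniform on `[0, π]`) -/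

/-- For `0 ≤ θ ≤ φ ≤ π`: `2(φ - θ)² ≤ π² (cos θ - cos φ)`
(`cos θ - cos φ = 2 sin((θ+φ)/2) sin((φ-θ)/2) ≥ 2 sin²((φ-θ)/2)` and Jordan's inequality). [folklore] -/
theorem two_mul_sq_sub_le_of_le {θ φ : ℝ} (hθ : 0 ≤ θ) (hθφ : θ ≤ φ) (hφ : φ ≤ π) :
    2 * (φ - θ) ^ 2 ≤ π ^ 2 * (Real.cos θ - Real.cos φ) := by
  set a := (φ - θ) / 2 with ha
  set b := (θ + φ) / 2 with hb
  have ha0 : 0 ≤ a := by rw [ha]; linarith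
  have ha2 : a ≤ π / 2 := by rw [ha]; linarith
  have hab : a ≤ b := by rw [ha, hb]; linarith
  have hba : b ≤ π - a := by rw [ha, hb]; linarith
  have hcos : Real.cos θ - Real.cos φ = 2 * Real.sin b * Real.sin a := by
    rw [Real.cos_sub_cos, hb, ha]
    have : Real.sin ((θ - φ) / 2) = -Real.sin ((φ - θ) / 2) := by
      rw [← Real.sin_neg]; congr 1; ring
    rw [this]; ring
  have hsina : 2 / π * a ≤ Real.sin a := Real.mul_le_sin ha0 ha2
  have hsina0 : 0 ≤ Real.sin a := le_trans (by positivity) hsina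
  -- `sin b ≥ sin a`
  have hsinb : Real.sin a ≤ Real.sin b := by
    rcases le_or_gt b (π / 2) with hb2 | hb2
    · exact Real.sin_le_sin_of_le_of_le_pi_div_two (by linarith) hb2 hab
    · rw [← Real.sin_pi_sub b]
      exact Real.sin_le_sin_of_le_of_le_pi_div_two (by linarith) (by linarith) (by linarith)
  have h1 : 2 * Real.sin a * Real.sin a ≤ Real.cos θ - Real.cos φ := by
    rw [hcos]
    have := mul_le_mul_of_nonneg_right hsinb hsina0
    linarith
  have h2 : (2 / π * a) ^ 2 ≤ Real.sin a ^ 2 := pow_le_pow_left₀ (by positivity) hsina 2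
  have hφθ : φ - θ = 2 * a := by rw [ha]; ring
  rw [hφθ]
  have hπ : 0 < π := Real.pi_pos
  have h3 : π ^ 2 * (2 / π * a) ^ 2 = 4 * a ^ 2 := by field_simp; ring
  nlinarith [h1, h2, h3, sq_nonneg (Real.sin a)]

/-- For `θ, φ ∈ [0, π]`: `2(θ - φ)² ≤ π² |cos θ - cos φ|`. [folklore] -/
theorem two_mul_sq_sub_le {θ φ : ℝ} (hθ : θ ∈ Icc 0 π) (hφ : φ ∈ Icc 0 π) :
    2 * (θ - φ) ^ 2 ≤ π ^ 2 * |Real.cos θ - Real.cos φ| := by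
  rcases le_total θ φ with h | h
  · have := two_mul_sq_sub_le_of_le hθ.1 h hφ.2
    calc 2 * (θ - φ) ^ 2 = 2 * (φ - θ) ^ 2 := by ring
      _ ≤ π ^ 2 * (Real.cos θ - Real.cos φ) := this
      _ ≤ π ^ 2 * |Real.cos θ - Real.cos φ| := by gcongr; exact le_abs_self _
  · have := two_mul_sq_sub_le_of_le hφ.1 h hθ.2
    calc 2 * (θ - φ) ^ 2 ≤ π ^ 2 * (Real.cos φ - Real.cos θ) := this
      _ ≤ π ^ 2 * |Real.cos θ - Real.cos φ| := by
          gcongr; rw [abs_sub_comm]; exact le_abs_self _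

/-- **Square-root modulus of `arccos`, uniformly on `[0, π]`**: if `θ, φ ∈ [0, π]` and
`|cos θ - cos φ| < 2h` then `|θ - φ| < π √h`. [folklore] -/
theorem abs_sub_lt_pi_mul_sqrt {θ φ h : ℝ} (hθ : θ ∈ Icc 0 π) (hφ : φ ∈ Icc 0 π)
    (hc : |Real.cos θ - Real.cos φ| < 2 * h) : |θ - φ| < π * Real.sqrt h := by
  have hπ : 0 < π := Real.pi_pos
  have h2 := two_mul_sq_sub_le hθ hφ
  have hh : 0 < h := by
    have := abs_nonneg (Real.cos θ - Real.cos φ); linarith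
  have hsq : (θ - φ) ^ 2 < (π * Real.sqrt h) ^ 2 := by
    rw [mul_pow, Real.sq_sqrt hh.le]
    nlinarith [mul_lt_mul_of_pos_left hc (by positivity : (0 : ℝ) < π ^ 2)]
  exact abs_lt_of_sq_lt_sq' hsq (by positivity) |>.elim (fun h1 h2 => abs_sub_lt_iff.2 ⟨by linarith, by linarith⟩)

/-! ### One row of the torus, uniformly in the offset -/

variable {L : ℕ} [NeZero L]

/-- A residue with folded index `m` has representative `m` or `L - m`: the folding
`a ↦ min(a, L - a)` is at most two-to-one. [folklore] -/
theorem card_filter_folded_eq_le_two (R : Finset (ZMod L)) (m : ℕ) :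
    (R.filter fun a : ZMod L => min a.val (L - a.val) = m).card ≤ 2 := by
  classical
  calc (R.filter fun a : ZMod L => min a.val (L - a.val) = m).card
      ≤ ({m, L - m} : Finset ℕ).card := by
        refine Finset.card_le_card_of_injOn (fun a => a.val) ?_ ?_
        · intro a ha
          rw [Finset.mem_coe, Finset.mem_filter] at ha
          rw [Finset.mem_coe, Finset.mem_insert, Finset.mem_singleton]
          change a.val = m ∨ a.val = L - m
          have hle : a.val ≤ L := (ZMod.val_lt a).le
          rcases le_total a.val (L - a.val) with h | h
          · left; rw [min_eq_left h] at ha; exact ha.2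
          · right; rw [min_eq_right h] at ha; omega
        · intro a _ b _ hab
          exact ZMod.val_injective L hab
    _ ≤ 2 := Finset.card_le_two

/-- **Uniform row count.** For any real `h` and `c`, the residues `a ∈ ℤ/Lℤ` with
`|cos(2πa/L) - c| < h` are at most `L√h + 2` in number: their folded angles are pairwise closer
than `π√h`, so the folded indices form a set of diameter `< L√h/2`, and folding is two-to-one. [folklore] -/
theorem card_row_le_sqrt (h c : ℝ) :
    ((Finset.univ.filter fun a : ZMod L => |Real.cos (2 * π * (a.val : ℝ) / L) - c| < h).card : ℝ) ≤
      L * Real.sqrt h + 2 := by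
  classical
  have hL : (0 : ℝ) < L := by exact_mod_cast Nat.pos_of_ne_zero (NeZero.ne L)
  set R := Finset.univ.filter fun a : ZMod L => |Real.cos (2 * π * (a.val : ℝ) / L) - c| < h with hR
  set fold : ZMod L → ℕ := fun a => min a.val (L - a.val) with hfold
  -- folding is two-to-one
  have h2 : R.card ≤ 2 * (R.image fold).card :=
    Finset.card_le_mul_card_image R 2 fun m _ => card_filter_folded_eq_le_two R m
  -- the folded indices have small diameter
  have hdiam : ((R.image fold).card : ℝ) ≤ L * Real.sqrt h / 2 + 1 := by
    refine card_le_of_forall_sub_lt (by positivity) ?_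
    intro x hx y hy
    rw [Finset.mem_image] at hx hy
    obtain ⟨a, ha, rfl⟩ := hx
    obtain ⟨b, hb, rfl⟩ := hy
    rw [hR, Finset.mem_filter] at ha hb
    have hca := cos_angle_eq_cos_folded a
    have hcb := cos_angle_eq_cos_folded b
    set θa := 2 * π * ((min a.val (L - a.val) : ℕ) : ℝ) / L with hθa
    set θb := 2 * π * ((min b.val (L - b.val) : ℕ) : ℝ) / L with hθb
    have hcos : |Real.cos θa - Real.cos θb| < 2 * h := by
      rw [← hca, ← hcb]
      have h1 := ha.2
      have h2 := hb.2
      rw [abs_lt] at h1 h2 ⊢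
      constructor <;> linarith
    have hθ := abs_sub_lt_pi_mul_sqrt (folded_angle_mem_Icc a) (folded_angle_mem_Icc b) hcos
    have hdiff : θb - θa = 2 * π / L * (((fold b : ℕ) : ℝ) - ((fold a : ℕ) : ℝ)) := by
      rw [hθa, hθb, hfold]; field_simp
    have h2πL : 0 < 2 * π / L := by positivity
    calc (((fold b : ℕ) : ℝ) - ((fold a : ℕ) : ℝ)) = (θb - θa) / (2 * π / L) := by
          rw [hdiff]; field_simp
      _ ≤ |θa - θb| / (2 * π / L) := by
          gcongr
          rw [abs_sub_comm]; exact le_abs_self _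
      _ < π * Real.sqrt h / (2 * π / L) := by gcongr
      _ = L * Real.sqrt h / 2 := by field_simp
  calc (R.card : ℝ) ≤ ((2 * (R.image fold).card : ℕ) : ℝ) := by exact_mod_cast h2
    _ = 2 * ((R.image fold).card : ℝ) := by push_cast; ring
    _ ≤ 2 * (L * Real.sqrt h / 2 + 1) := by gcongr
    _ = L * Real.sqrt h + 2 := by ring

/-! ### The whole torus -/

/-- **Level counting on the torus, uniformly in the chemical potential.** For every real `μ` and
every real `t`: `#{k ∈ (ℤ/Lℤ)² : |ε_L(k) - μ| < t} ≤ L (L√(t/2) + 2)` (`√` is `Real.sqrt`, `0` on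
negative reals). [folklore] -/
theorem card_torusShell_le_sqrt (μ t : ℝ) :
    ((Finset.univ.filter fun k : TorusSite 2 L => |torusBand L k - μ| < t).card : ℝ) ≤
      L * (L * Real.sqrt (t / 2) + 2) := by
  classical
  set S := Finset.univ.filter fun k : TorusSite 2 L => |torusBand L k - μ| < t with hS
  -- fibre over the second coordinate
  have hfib := Finset.card_eq_sum_card_fiberwise (f := fun k : TorusSite 2 L => k 1) (s := S)
    (t := Finset.univ) (fun _ _ => Finset.mem_univ _)
  have hrow : ∀ r : ZMod L, (((S.filter fun k => k 1 = r)).card : ℝ) ≤ L * Real.sqrt (t / 2) + 2 := by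
    intro r
    set c : ℝ := -Real.cos (2 * π * (r.val : ℝ) / L) - μ / 2 with hc
    refine le_trans ?_ (card_row_le_sqrt (L := L) (t / 2) c)
    refine Nat.cast_le.2 (Finset.card_le_card_of_injOn (fun k => k 0) ?_ ?_)
    · intro k hk
      rw [Finset.mem_coe, Finset.mem_filter, hS, Finset.mem_filter] at hk
      obtain ⟨⟨_, hsh⟩, hkr⟩ := hk
      rw [Finset.mem_coe, Finset.mem_filter]
      refine ⟨Finset.mem_univ _, ?_⟩
      rw [torusBand_two_eq, hkr] at hsh
      have : torusBand L k - μ = -2 * (Real.cos (2 * π * (((k 0).val : ℕ) : ℝ) / L) - c) := by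
        rw [torusBand_two_eq, hkr, hc]; ring
      have h' : |-2 * (Real.cos (2 * π * (((k 0).val : ℕ) : ℝ) / L) - c)| < t := by
        rw [torusBand_two_eq, hkr] at this
        rw [← this]; exact hsh
      rw [abs_mul, abs_neg, abs_two] at h'
      linarith
    · intro k hk k' hk' hkk'
      rw [Finset.mem_coe, Finset.mem_filter] at hk hk'
      funext l
      fin_cases l
      · exact hkk'
      · exact hk.2.trans hk'.2.symm
  calc (S.card : ℝ) = ∑ r : ZMod L, (((S.filter fun k => k 1 = r)).card : ℝ) := by
        rw [hfib]; push_cast; rfl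
    _ ≤ ∑ _r : ZMod L, (L * Real.sqrt (t / 2) + 2) := Finset.sum_le_sum fun r _ => hrow r
    _ = L * (L * Real.sqrt (t / 2) + 2) := by
        rw [Finset.sum_const, Finset.card_univ, ZMod.card, nsmul_eq_mul]

end Summit.HubbardSuperconductivity.TwTipContinuation.WeakCouplingDarkness

namespace Summit.HubbardSuperconductivity.TwTipContinuation.WeakCouplingDarkness

open Literature.MathematicalPhysics.QuantumLattice Literature.Probability.LatticeModels

/-- **Uniform thin-shell level count (piece 1 of the weak-coupling darkness bound for
`TwTipContinuation`)**, closed form: for every side `L ≥ 1`, every real `μ` and `t`,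
`#{k ∈ (ℤ/Lℤ)² : |ε_L(k) - μ| < t} ≤ L (L√(t/2) + 2)`. [folklore] -/
theorem torusShell_count_uniform :
    ∀ (L : ℕ) [NeZero L] (μ t : ℝ), ((Finset.univ.filter fun k : TorusSite 2 L => |torusBand L k - μ| < t).card : ℝ) ≤ L * (L * Real.sqrt (t / 2) + 2) :=
  fun _ _ μ t => card_torusShell_le_sqrt μ t

end Summit.HubbardSuperconductivity.TwTipContinuation.WeakCouplingDarkness
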